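import Mathlib.MeasureTheory.Function.UnifTight
import Mathlib.MeasureTheory.Integral.Bochner.Set
import HarnessLib

/-!
# Weak sequential compactness in `L¹`: the Dunford–Pettis theorem and the
de la Vallée-Poussin / moment criteria

Topic: Analysis / FunctionSpaces (general measure theory used by kinetic theory: step 8 of the
DiPerna–Lions global existence proof for the Boltzmann equation, Cercignani–Illner–Pulvirenti
1994 §5.3, is exactly this material).

* `Literature.TendstoWeaklyL1 f g μ`: the sequence `f n` converges to `g` *weakly in `L¹(μ)`*, tested
  against essentially bounded measurable multipliers `φ` (for `σ`-finite `μ` this is the weak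
  topology `σ(L¹, (L¹)') = σ(L¹, L^∞)`).
* `Literature.Analysis.FunctionSpaces.unifIntegrable_of_lintegral_superlinear_le` (**proved**; de la Vallée-Poussin, easy
  direction; Fonseca–Leoni 2007 Thm 2.29 (iii) ⇒ (i); CIP 1994 §5.3 (3.25)): a uniform bound
  `∫ γ(‖f i‖) dμ ≤ M < ∞` with `γ(t)/t → ∞` gives equi-integrability (`MeasureTheory.UnifIntegrable`).
* `Literature.Analysis.FunctionSpaces.unifTight_of_lintegral_weight_le` (**proved**; CIP 1994 §5.3 (3.25)): a uniform bound
  `∫ w ‖f i‖ dμ ≤ M < ∞` with a weight `w` whose sublevel sets have finite measure gives uniform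
  tightness (`MeasureTheory.UnifTight`).
* `Literature.Analysis.FunctionSpaces.dunfordPettis_exists_subseq`, `Literature.Analysis.FunctionSpaces.dunfordPettis_necessary` (named facts; Fonseca–Leoni
  2007 Thm 2.54; Dunford–Schwartz I, IV.8.9–IV.8.11; CIP 1994 §5.3 Step 8): on a `σ`-finite measure
  space a sequence which is bounded in `L¹`, equi-integrable and uniformly tight has a weakly
  convergent subsequence with an `L¹` limit, and conversely a weakly convergent sequence of `L¹`
  functions is bounded, equi-integrable and uniformly tight.

## Mathlib

Mathlib has `MeasureTheory.UnifIntegrable` (equi-integrability), `MeasureTheory.UniformIntegrable`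
(measurable + equi-integrable + bounded in `L^p`), `MeasureTheory.UnifTight` and Vitali's
convergence theorem (`MeasureTheory.tendstoInMeasure_iff_tendsto_Lp`), and the constructor
`MeasureTheory.unifIntegrable_of`; it has no Dunford–Pettis theorem, no `L¹`–`L^∞` duality and
no de la Vallée-Poussin criterion (searched `Dunford`, `Pettis`, `Vallee`, `superlinear`,
`equiintegrable` in Mathlib: nothing beyond the above). Weak convergence is therefore recorded
concretely (`TendstoWeaklyL1`), as in the kinetic-theory literature.

## References

* I. Fonseca, G. Leoni, *Modern Methods in the Calculus of Variations: `L^p` Spaces*, Springer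
  (2007), Thm 2.29 (p. 158) and Thm 2.54 (Dunford–Pettis, p. 175).
* N. Dunford, J. T. Schwartz, *Linear Operators I* (1958), IV.8.9–IV.8.11.
* C. Cercignani, R. Illner, M. Pulvirenti, *The Mathematical Theory of Dilute Gases*, Springer
  (1994), §5.3 Step 8 (pp. 147–148), estimate (3.25).
-/

noncomputable section

open MeasureTheory Filter Topology Set
open scoped ENNReal NNReal

namespace Literature.Analysis.FunctionSpaces

variable {α : Type*} [MeasurableSpace α] {μ : Measure α}

/-! ## Weak convergence in `L¹` -/

/-- `TendstoWeaklyL1 f g μ`: the sequence `(f n)` converges to `g` *weakly in `L¹(μ)`* in the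
concrete sense used throughout kinetic theory: for every a.e.-strongly measurable, essentially
bounded multiplier `φ`, `∫ f n · φ dμ → ∫ g · φ dμ` (Fonseca–Leoni 2007, Thm 2.54 and the
duality `(L¹)' = L^∞` for `σ`-finite `μ`, so that this is convergence in `σ(L¹, (L¹)')`).
No integrability is built in (the Bochner integrals are junk `0` otherwise); the facts below
carry their own `Integrable` hypotheses/conclusions. [cite: FonsecaLeoni2007, Thm 2.54] -/
def TendstoWeaklyL1 (f : ℕ → α → ℝ) (g : α → ℝ) (μ : Measure α) : Prop :=
  ∀ (φ : α → ℝ) (C : ℝ), AEStronglyMeasurable φ μ → (∀ᵐ x ∂μ, |φ x| ≤ C) →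
    Tendsto (fun n => ∫ x, f n x * φ x ∂μ) atTop (𝓝 (∫ x, g x * φ x ∂μ))

/-- A constant sequence converges weakly to its value. [folklore] -/
theorem tendstoWeaklyL1_const (g : α → ℝ) (μ : Measure α) : TendstoWeaklyL1 (fun _ => g) g μ :=
  fun _ _ _ _ => tendsto_const_nhds

/-- Subsequences of weakly convergent sequences converge weakly to the same limit. [folklore] -/
theorem TendstoWeaklyL1.comp_strictMono {f : ℕ → α → ℝ} {g : α → ℝ} (h : TendstoWeaklyL1 f g μ)
    {ψ : ℕ → ℕ} (hψ : StrictMono ψ) : TendstoWeaklyL1 (f ∘ ψ) g μ :=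
  fun φ C hφ hC => (h φ C hφ hC).comp hψ.tendsto_atTop

/-- Weak convergence tested on a measurable set: `∫_s f n → ∫_s g` (take `φ = 1_s`). [folklore] -/
theorem TendstoWeaklyL1.tendsto_setIntegral {f : ℕ → α → ℝ} {g : α → ℝ}
    (h : TendstoWeaklyL1 f g μ) {s : Set α} (hs : MeasurableSet s) :
    Tendsto (fun n => ∫ x in s, f n x ∂μ) atTop (𝓝 (∫ x in s, g x ∂μ)) := by
  have key := h (s.indicator fun _ => (1 : ℝ)) 1
    ((aestronglyMeasurable_const (b := (1 : ℝ))).indicator hs)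
    (Eventually.of_forall fun x => by
      by_cases hx : x ∈ s <;> simp [Set.indicator, hx])
  have hrw : ∀ u : α → ℝ, ∫ x, u x * s.indicator (fun _ => (1 : ℝ)) x ∂μ = ∫ x in s, u x ∂μ := by
    intro u
    rw [← integral_indicator hs]
    congr 1
    ext x
    by_cases hx : x ∈ s <;> simp [Set.indicator, hx]
  simpa only [hrw] using key

/-- Strong `L¹` convergence of integrable functions, `∫ |f n - g| dμ → 0`, implies weak `L¹`
convergence (Hölder `L¹`–`L^∞`). [folklore] -/
theorem TendstoWeaklyL1.of_tendsto_integral_abs_sub {f : ℕ → α → ℝ} {g : α → ℝ}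
    (hf : ∀ n, Integrable (f n) μ) (hg : Integrable g μ)
    (h : Tendsto (fun n => ∫ x, |f n x - g x| ∂μ) atTop (𝓝 0)) : TendstoWeaklyL1 f g μ := by
  intro φ C hφ hC
  have hC0 : ∀ᵐ x ∂μ, ‖φ x‖ ≤ max C 0 :=
    hC.mono fun x hx => (Real.norm_eq_abs _).le.trans (hx.trans (le_max_left _ _))
  have hfφ : ∀ n, Integrable (fun x => f n x * φ x) μ := fun n => (hf n).mul_bdd hφ hC0
  have hgφ : Integrable (fun x => g x * φ x) μ := hg.mul_bdd hφ hC0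
  rw [tendsto_iff_norm_sub_tendsto_zero]
  refine squeeze_zero (fun n => norm_nonneg _) (fun n => ?_)
    (by simpa using h.const_mul (max C 0))
  -- `‖∫ fₙ φ - ∫ g φ‖ ≤ max C 0 * ∫ |fₙ - g|`
  rw [← integral_sub (hfφ n) hgφ]
  calc ‖∫ x, (f n x * φ x - g x * φ x) ∂μ‖
      ≤ ∫ x, ‖f n x * φ x - g x * φ x‖ ∂μ := norm_integral_le_integral_norm _
    _ ≤ ∫ x, max C 0 * |f n x - g x| ∂μ := by
        refine integral_mono_ae ((hfφ n).sub hgφ).norm (((hf n).sub hg).abs.const_mul _) ?_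
        filter_upwards [hC] with x hx
        rw [← sub_mul, norm_mul, Real.norm_eq_abs, Real.norm_eq_abs, mul_comm]
        exact mul_le_mul_of_nonneg_right (hx.trans (le_max_left _ _)) (abs_nonneg _)
    _ = max C 0 * ∫ x, |f n x - g x| ∂μ := integral_const_mul _ _

/-! ## Criteria for equi-integrability and tightness (CIP 1994 (3.25)) -/

variable {ι : Type*} {β : Type*} [NormedAddCommGroup β]

/-- **de la Vallée-Poussin criterion** (sufficiency; Fonseca–Leoni 2007 Thm 2.29 (iii) ⇒ (i),
p. 158; CIP 1994 §5.3 (3.25), first summand). If `γ : ℝ → ℝ` is superlinear at infinity,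
`γ(t)/t → +∞`, and `sup_i ∫ γ(‖f i‖) dμ ≤ M < ∞`, then the family `(f i)` is equi-integrable
(`MeasureTheory.UnifIntegrable _ 1`). (Monotonicity of `γ`, assumed by Fonseca–Leoni, is not
used in their proof and is not assumed here; `γ` enters through `ENNReal.ofReal ∘ γ`, i.e. its
negative part is discarded, which only weakens the hypothesis where `γ < 0`.) [cite: FonsecaLeoni2007, Thm 2.29] -/
theorem unifIntegrable_of_lintegral_superlinear_le {f : ι → α → β}
    (hf : ∀ i, AEStronglyMeasurable (f i) μ) {γ : ℝ → ℝ}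
    (hγ : Tendsto (fun t => γ t / t) atTop atTop) {M : ℝ≥0∞} (hM : M ≠ ∞)
    (hbound : ∀ i, ∫⁻ x, ENNReal.ofReal (γ ‖f i x‖) ∂μ ≤ M) : UnifIntegrable f 1 μ := by
  refine unifIntegrable_of le_rfl ENNReal.one_ne_top hf fun ε hε => ?_
  -- choose `C₀` with `γ t / t ≥ K := M/ε + 1` for `t ≥ C₀`
  set K : ℝ := M.toReal / ε + 1 with hK_def
  have hKpos : 0 < K := by positivity
  obtain ⟨C₀, hC₀⟩ := (hγ.eventually_ge_atTop K).exists_forall_of_atTop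
  set C : ℝ≥0 := ⟨max C₀ 1, (zero_le_one.trans (le_max_right _ _))⟩ with hC_def
  refine ⟨C, fun i => ?_⟩
  -- pointwise bound on the truncated function
  have hpt : ∀ x, ‖{x | C ≤ ‖f i x‖₊}.indicator (f i) x‖ₑ ≤
      ENNReal.ofReal K⁻¹ * ENNReal.ofReal (γ ‖f i x‖) := by
    intro x
    by_cases hx : x ∈ {x | C ≤ ‖f i x‖₊}
    · rw [indicator_of_mem hx]
      have hxC : (C : ℝ) ≤ ‖f i x‖ := by
        have := hx; simp only [mem_setOf_eq] at this
        exact_mod_cast this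
      have hCval : ((C : ℝ≥0) : ℝ) = max C₀ 1 := by rw [hC_def]; rfl
      have ht1 : (1 : ℝ) ≤ ‖f i x‖ := le_trans (hCval ▸ le_max_right C₀ 1) hxC
      have ht0 : (0 : ℝ) < ‖f i x‖ := one_pos.trans_le ht1
      have hC₀t : C₀ ≤ ‖f i x‖ := le_trans (hCval ▸ le_max_left C₀ 1) hxC
      have hγt : K ≤ γ ‖f i x‖ / ‖f i x‖ := hC₀ _ hC₀t
      have hle : ‖f i x‖ ≤ K⁻¹ * γ ‖f i x‖ := by
        rw [le_div_iff₀ ht0] at hγt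
        rw [inv_mul_eq_div, le_div_iff₀' hKpos]
        linarith
      calc ‖f i x‖ₑ = ENNReal.ofReal ‖f i x‖ := (ofReal_norm _).symm
        _ ≤ ENNReal.ofReal (K⁻¹ * γ ‖f i x‖) := ENNReal.ofReal_le_ofReal hle
        _ = ENNReal.ofReal K⁻¹ * ENNReal.ofReal (γ ‖f i x‖) :=
            ENNReal.ofReal_mul (inv_nonneg.2 hKpos.le)
    · simp [indicator_of_notMem hx]
  calc eLpNorm ({x | C ≤ ‖f i x‖₊}.indicator (f i)) 1 μ
      = ∫⁻ x, ‖{x | C ≤ ‖f i x‖₊}.indicator (f i) x‖ₑ ∂μ := eLpNorm_one_eq_lintegral_enorm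
    _ ≤ ∫⁻ x, ENNReal.ofReal K⁻¹ * ENNReal.ofReal (γ ‖f i x‖) ∂μ := lintegral_mono hpt
    _ = ENNReal.ofReal K⁻¹ * ∫⁻ x, ENNReal.ofReal (γ ‖f i x‖) ∂μ := by
        rw [lintegral_const_mul' _ _ ENNReal.ofReal_ne_top]
    _ ≤ ENNReal.ofReal K⁻¹ * M := by gcongr; exact hbound i
    _ = ENNReal.ofReal (K⁻¹ * M.toReal) := by
        rw [ENNReal.ofReal_mul (inv_nonneg.2 hKpos.le), ENNReal.ofReal_toReal hM]
    _ ≤ ENNReal.ofReal ε := by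
        refine ENNReal.ofReal_le_ofReal ?_
        rw [inv_mul_le_iff₀ hKpos, hK_def]
        have : M.toReal = ε * (M.toReal / ε) := by field_simp
        nlinarith [ENNReal.toReal_nonneg (a := M)]

/-- **Moment (weight) criterion for uniform tightness** (CIP 1994 §5.3 (3.25), second summand:
`sup_n ∫ |fₙ| (1 + w) < ∞` with `w → ∞` at infinity gives condition (ii c) of the Dunford–Pettis
criterion). General form: if the sublevel sets `{w ≤ R}` of a weight `w : α → ℝ` have finite
measure and `sup_i ∫ w ‖f i‖ dμ ≤ M < ∞`, then `(f i)` is uniformly tight in `L¹`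
(`MeasureTheory.UnifTight _ 1`): outside `{w ≤ R}` one has `‖f i‖ ≤ w ‖f i‖ / R`. [cite: CIP1994, §5.3 (3.25)] -/
theorem unifTight_of_lintegral_weight_le {f : ι → α → β} {w : α → ℝ}
    (hw : ∀ R : ℝ, μ {x | w x ≤ R} ≠ ∞) {M : ℝ≥0∞} (hM : M ≠ ∞)
    (hbound : ∀ i, ∫⁻ x, ENNReal.ofReal (w x) * ‖f i x‖ₑ ∂μ ≤ M) : UnifTight f 1 μ := by
  rw [unifTight_iff_real]
  intro ε hε
  set R : ℝ := M.toReal / ε + 1 with hR_def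
  have hRpos : 0 < R := by positivity
  refine ⟨{x | w x ≤ R}, hw R, fun i => ?_⟩
  have hpt : ∀ x, ‖{x | w x ≤ R}ᶜ.indicator (f i) x‖ₑ ≤
      ENNReal.ofReal R⁻¹ * (ENNReal.ofReal (w x) * ‖f i x‖ₑ) := by
    intro x
    by_cases hx : x ∈ {x | w x ≤ R}ᶜ
    · rw [indicator_of_mem hx]
      have hRw : R ≤ w x := by
        simp only [mem_compl_iff, mem_setOf_eq, not_le] at hx
        exact hx.le
      calc ‖f i x‖ₑ = ENNReal.ofReal (R⁻¹ * R) * ‖f i x‖ₑ := by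
            rw [inv_mul_cancel₀ hRpos.ne', ENNReal.ofReal_one, one_mul]
        _ ≤ ENNReal.ofReal (R⁻¹ * w x) * ‖f i x‖ₑ := by
            gcongr
        _ = ENNReal.ofReal R⁻¹ * (ENNReal.ofReal (w x) * ‖f i x‖ₑ) := by
            rw [ENNReal.ofReal_mul (inv_nonneg.2 hRpos.le), mul_assoc]
    · simp [indicator_of_notMem hx]
  calc eLpNorm ({x | w x ≤ R}ᶜ.indicator (f i)) 1 μ
      = ∫⁻ x, ‖{x | w x ≤ R}ᶜ.indicator (f i) x‖ₑ ∂μ := eLpNorm_one_eq_lintegral_enorm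
    _ ≤ ∫⁻ x, ENNReal.ofReal R⁻¹ * (ENNReal.ofReal (w x) * ‖f i x‖ₑ) ∂μ := lintegral_mono hpt
    _ = ENNReal.ofReal R⁻¹ * ∫⁻ x, ENNReal.ofReal (w x) * ‖f i x‖ₑ ∂μ := by
        rw [lintegral_const_mul' _ _ ENNReal.ofReal_ne_top]
    _ ≤ ENNReal.ofReal R⁻¹ * M := by gcongr; exact hbound i
    _ = ENNReal.ofReal (R⁻¹ * M.toReal) := by
        rw [ENNReal.ofReal_mul (inv_nonneg.2 hRpos.le), ENNReal.ofReal_toReal hM]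
    _ ≤ ENNReal.ofReal ε := by
        refine ENNReal.ofReal_le_ofReal ?_
        rw [inv_mul_le_iff₀ hRpos, hR_def]
        have : M.toReal = ε * (M.toReal / ε) := by field_simp
        nlinarith [ENNReal.toReal_nonneg (a := M)]

/-! ## The Dunford–Pettis theorem (named facts) -/

/-- **Dunford–Pettis theorem, compactness direction** (Fonseca–Leoni 2007 Thm 2.54, sufficiency,
p. 175; Dunford–Schwartz I, Cor. IV.8.11; CIP 1994 §5.3 Step 8 (ii) ⇒ (i)). On a `σ`-finite
measure space, a sequence `(f n)` which is bounded in `L¹`, equi-integrable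
(`MeasureTheory.UniformIntegrable f 1 μ` bundles: each `f n` a.e.-strongly measurable,
equi-integrable, `sup_n ‖f n‖₁ < ∞`) and uniformly tight (`MeasureTheory.UnifTight f 1 μ`:
for every `ε` some set of finite measure carries all of `‖f n‖₁` up to `ε`) has a subsequence
converging weakly in `L¹` (`TendstoWeaklyL1`, i.e. in `σ(L¹, L^∞) = σ(L¹, (L¹)')` for `σ`-finite
`μ`) to some `g ∈ L¹(μ)`. [cite: FonsecaLeoni2007, Thm 2.54] -/
def dunfordPettis_exists_subseq : Prop :=
  ∀ {α : Type*} [MeasurableSpace α] {μ : Measure α} [SigmaFinite μ] {f : ℕ → α → ℝ},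
    UniformIntegrable f 1 μ → UnifTight f 1 μ →
      ∃ ψ : ℕ → ℕ, StrictMono ψ ∧ ∃ g : α → ℝ, Integrable g μ ∧ TendstoWeaklyL1 (f ∘ ψ) g μ

/-- **Dunford–Pettis theorem, necessity direction** (Fonseca–Leoni 2007 Thm 2.54, necessity
(Step 1 of the proof, via Vitali–Hahn–Saks), p. 175; CIP 1994 §5.3 Step 8 (i) ⇒ (ii)). On a
`σ`-finite measure space, a sequence of integrable functions converging weakly in `L¹` (to an
integrable limit) is bounded in `L¹`, equi-integrable and uniformly tight — a weakly convergent
sequence being a weakly sequentially precompact family. [cite: FonsecaLeoni2007, Thm 2.54] -/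
def dunfordPettis_necessary : Prop :=
  ∀ {α : Type*} [MeasurableSpace α] {μ : Measure α} [SigmaFinite μ] {f : ℕ → α → ℝ} {g : α → ℝ},
    (∀ n, Integrable (f n) μ) → Integrable g μ → TendstoWeaklyL1 f g μ →
      UniformIntegrable f 1 μ ∧ UnifTight f 1 μ

end Literature.Analysis.FunctionSpaces
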